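import Mathlib
import HarnessLib
import Summits.ValiantsHypothesis.ValiantsHypothesis.Theorems.LacunarySymmetroidMatrixDescartesOsculationLawCuspCubicNonMonicAlgebra
import Summits.ValiantsHypothesis.ValiantsHypothesis.Theorems.LacunarySymmetroidMatrixDescartesOsculationLawCuspCubicNonMonicReductionPoly
import Summits.ValiantsHypothesis.ValiantsHypothesis.Theorems.LacunarySymmetroidMatrixDescartesOsculationCensusRankOneLower

/-!
# ValiantsHypothesis / LacunarySymmetroid — crux `MatrixDescartes` (stmt-ValiantsHypothesis-18050, V1),
# line «osculation-law» (`Cruxes/MatrixDescartes/Lines/osculation_law.lean`), rung O3 «extremal-support families from the census»: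
# the RANK-THREE certificate at a GENERAL splitting `(3, s)` — non-monic cubic letter: the LOWER side from sign windows (companion file of the UPPER side)

Roster R2664 (b) / R2685 (O3 = val-sym-engine-7; this file engine-7 g5).  Companion of ✓ `…OsculationCensusRankThreeTopCert` (g4, the monic top
splitting `(3,0)`), ✓ `…RankTwoSCert` (`(2,s)`), ✓ `…RankOneCert` (`(1,s)`).  Needed for the O3 table's `(3,1)` entries (F5 = the `ν(4,3) = 10`
extremiser at its four rank-three splittings; located-exact 0 / 1 / 2 / 2, OSC-TABLE-g3) which have no kernel counterpart so far.

CONTENT (every `K`, every `s`; the line's `osculationSet d S` with `blockProj`, `insertionPoly`, `euler`, `logHessian` UNFOLDED verbatim).  The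
insertion polynomial at `(3,s)` is a cubic `Ψ(t,b) = a₃(t)b³ + a₂(t)b² + a₁(t)b + a₀(t)` (`a₃ = det G₂₂`, `a₀ = det G`; hypothesis `hΦ`, discharged at
`s = 1` by ✓ `OsculationCensus.insertionPoly_three_one`); on the curve `a₃(t)⁶·H(t,b) = R₂(t)b² + R₁(t)b + R₀(t)` with the tree's pseudo-remainder
polynomials (✓ `OsculationRankThree.hess_pseudo_reduce_poly3`, texts of `hR2/hR1/hR0` VERBATIM), so `R₂b² + R₁b + R₀ = 0` at every osculation point; one
Euclid step gives `L₁(t) b + L₀(t) = 0` (`L₁ = a₁R₂² − a₃R₀R₂ − a₂R₁R₂ + a₃R₁²`, `L₀ = a₀R₂² − a₂R₀R₂ + a₃R₀R₁`) and then `N(t) = 0`,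
`N = R₂L₀² − R₁L₀L₁ + R₀L₁²` (plain `ring` identities, as in ✓ `OsculationCuspCubic.nonmonic_cubic_curve_ncard_le`).
* `osc_rankThreeS_finite_card_le` (UPPER): if `N ≢ 0`, `L₁ ≢ 0` and NO VERTICAL FIBRE (`a₃, a₂, a₁, a₀` have no common positive zero) the osculation set is
  FINITE with `ncard ≤ N_N + 3·N_L` (`deg N ≤ N_N`, `deg L₁ ≤ N_L`: an abscissa with `L₁ ≠ 0` is a root of `N` carrying ONE point `b = −L₀/L₁`, a root of `L₁`
  carries at most the three roots of the non-zero cubic fibre).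
* `osc_rankThreeS_card_ge` (LOWER): `k` pairwise separated windows `[l, u] ⊂ (0, ∞)` with `N(l)·N(u) ≤ 0` and `L₁·L₀ < 0`, `R₂ ≠ 0`, `a₃ ≠ 0` on `[l, u]`
  exhibit `k` distinct osculation points `(t, −L₀(t)/L₁(t))` (`R₂b²+R₁b+R₀ = N/L₁² = 0`; `Ψ = 0` by the Euclid identity and `R₂ ≠ 0`; `H = 0` by the
  reduction and `a₃ ≠ 0`), so `k ≤ ncard`.

HONEST FRAMING.  Calibration tooling for a line stub (`m = 4` is covered by `rungFour` / `rungAll`); the LAW `stub_osculationLaw`, the crux `MatrixDescartes`,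
Conjecture B and `VP ≠ VNP` are OPEN / NOT proved; no summit statement is proved by this file.  No definitions, no named facts; Mathlib + the tree files
`…CuspCubicNonMonicAlgebra` (`eval_Psi3`, `eval_logHessian_Psi3`), `…CuspCubicNonMonicReductionPoly` (`hess_pseudo_reduce_poly3`),
`…OsculationCensusRankOneLower` (`exists_root_of_mul_nonpos`).
-/

-- `Summit.ValiantsHypothesis.ValiantsHypothesis.…` is the tree's mandated single-conjunct layout (Sub = Summit).
set_option linter.dupNamespace false
-- the three reduction polynomials make the statements long left-nested sums: raise the elaborator's recursion budget.
set_option maxRecDepth 100000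

noncomputable section

namespace Summit.ValiantsHypothesis.ValiantsHypothesis.Theorems.LacunarySymmetroidMatrixDescartes

open Polynomial Matrix Finset
open scoped BigOperators

namespace OsculationCensus

-- the statement carries the three reduction polynomials and the osculation set twice.
set_option maxHeartbeats 1600000 in
/-- **Rank-three LOWER certificate, splitting `(3, s)`.**  See the module docstring. [folklore] -/
theorem osc_rankThreeS_card_ge {K s : ℕ} (d : Fin K → ℕ) (S : Fin K → Matrix (Fin 3 ⊕ Fin s) (Fin 3 ⊕ Fin s) ℝ)
    (a₃ a₂ a₁ a₀ R₂ R₁ R₀ L₁ L₀ : ℝ[X])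
    (hΦ : (∑ l, (MvPolynomial.X (0 : Fin 2) : MvPolynomial (Fin 2) ℝ) ^ d l •
              (S l).map (MvPolynomial.C : ℝ →+* MvPolynomial (Fin 2) ℝ)
            + (MvPolynomial.X (1 : Fin 2) : MvPolynomial (Fin 2) ℝ) •
              (Matrix.fromBlocks 1 0 0 0 : Matrix (Fin 3 ⊕ Fin s) (Fin 3 ⊕ Fin s) ℝ).map
                (MvPolynomial.C : ℝ →+* MvPolynomial (Fin 2) ℝ)).det =
      (MvPolynomial.X 1 * MvPolynomial.X 1 * MvPolynomial.X 1 * Polynomial.aeval (MvPolynomial.X 0 : MvPolynomial (Fin 2) ℝ) a₃ + MvPolynomial.X 1 * MvPolynomial.X 1 * Polynomial.aeval (MvPolynomial.X 0 : MvPolynomial (Fin 2) ℝ) a₂ + MvPolynomial.X 1 * Polynomial.aeval (MvPolynomial.X 0 : MvPolynomial (Fin 2) ℝ) a₁ + Polynomial.aeval (MvPolynomial.X 0 : MvPolynomial (Fin 2) ℝ) a₀))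
    (hR2 : R₂ = (6 : ℝ[X]) * a₃ ^ (6 : ℕ) * a₂ * a₀ * (X * derivative (X * derivative a₀)) - (5 : ℝ[X]) * a₃ ^ (6 : ℕ) * a₂ * (X * derivative a₀) ^ (2 : ℕ) + (4 : ℝ[X]) * a₃ ^ (6 : ℕ) * a₁ ^ (2 :
          ℕ) * (X * derivative (X * derivative a₀)) + (12 : ℝ[X]) * a₃ ^ (6 : ℕ) * a₁ * a₀ * (X * derivative (X * derivative a₁)) - (12 : ℝ[X]) * a₃ ^ (6 : ℕ) * a₁ * (X * derivative a₁) * (X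
          * derivative a₀) + (9 : ℝ[X]) * a₃ ^ (6 : ℕ) * a₀ ^ (2 : ℕ) * (X * derivative (X * derivative a₂)) - (6 : ℝ[X]) * a₃ ^ (6 : ℕ) * a₀ * (X * derivative a₂) * (X * derivative a₀) - (3
          : ℝ[X]) * a₃ ^ (6 : ℕ) * a₀ * (X * derivative a₁) ^ (2 : ℕ) - (5 : ℝ[X]) * a₃ ^ (5 : ℕ) * a₂ ^ (2 : ℕ) * a₁ * (X * derivative (X * derivative a₀)) - (7 : ℝ[X]) * a₃ ^ (5 : ℕ) * a₂
          ^ (2 : ℕ) * a₀ * (X * derivative (X * derivative a₁)) + (8 : ℝ[X]) * a₃ ^ (5 : ℕ) * a₂ ^ (2 : ℕ) * (X * derivative a₁) * (X * derivative a₀) - (8 : ℝ[X]) * a₃ ^ (5 : ℕ) * a₂ * a₁ ^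
          (2 : ℕ) * (X * derivative (X * derivative a₁)) - (22 : ℝ[X]) * a₃ ^ (5 : ℕ) * a₂ * a₁ * a₀ * (X * derivative (X * derivative a₂)) + (14 : ℝ[X]) * a₃ ^ (5 : ℕ) * a₂ * a₁ * (X *
          derivative a₂) * (X * derivative a₀) + (7 : ℝ[X]) * a₃ ^ (5 : ℕ) * a₂ * a₁ * (X * derivative a₁) ^ (2 : ℕ) - (15 : ℝ[X]) * a₃ ^ (5 : ℕ) * a₂ * a₀ ^ (2 : ℕ) * (X * derivative (X *
          derivative a₃)) + (4 : ℝ[X]) * a₃ ^ (5 : ℕ) * a₂ * a₀ * (X * derivative a₃) * (X * derivative a₀) + (4 : ℝ[X]) * a₃ ^ (5 : ℕ) * a₂ * a₀ * (X * derivative a₂) * (X * derivative a₁)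
          - (4 : ℝ[X]) * a₃ ^ (5 : ℕ) * a₁ ^ (3 : ℕ) * (X * derivative (X * derivative a₂)) - (16 : ℝ[X]) * a₃ ^ (5 : ℕ) * a₁ ^ (2 : ℕ) * a₀ * (X * derivative (X * derivative a₃)) + (4 :
          ℝ[X]) * a₃ ^ (5 : ℕ) * a₁ ^ (2 : ℕ) * (X * derivative a₃) * (X * derivative a₀) + (4 : ℝ[X]) * a₃ ^ (5 : ℕ) * a₁ ^ (2 : ℕ) * (X * derivative a₂) * (X * derivative a₁) - (6 : ℝ[X])
          * a₃ ^ (5 : ℕ) * a₁ * a₀ * (X * derivative a₃) * (X * derivative a₁) - (3 : ℝ[X]) * a₃ ^ (5 : ℕ) * a₁ * a₀ * (X * derivative a₂) ^ (2 : ℕ) - (12 : ℝ[X]) * a₃ ^ (5 : ℕ) * a₀ ^ (2 :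
          ℕ) * (X * derivative a₃) * (X * derivative a₂) + a₃ ^ (4 : ℕ) * a₂ ^ (4 : ℕ) * (X * derivative (X * derivative a₀)) + (6 : ℝ[X]) * a₃ ^ (4 : ℕ) * a₂ ^ (3 : ℕ) * a₁ * (X *
          derivative (X * derivative a₁)) + (8 : ℝ[X]) * a₃ ^ (4 : ℕ) * a₂ ^ (3 : ℕ) * a₀ * (X * derivative (X * derivative a₂)) - (6 : ℝ[X]) * a₃ ^ (4 : ℕ) * a₂ ^ (3 : ℕ) * (X * derivative
          a₂) * (X * derivative a₀) - (3 : ℝ[X]) * a₃ ^ (4 : ℕ) * a₂ ^ (3 : ℕ) * (X * derivative a₁) ^ (2 : ℕ) + (13 : ℝ[X]) * a₃ ^ (4 : ℕ) * a₂ ^ (2 : ℕ) * a₁ ^ (2 : ℕ) * (X * derivative (X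
          * derivative a₂)) + (34 : ℝ[X]) * a₃ ^ (4 : ℕ) * a₂ ^ (2 : ℕ) * a₁ * a₀ * (X * derivative (X * derivative a₃)) - (12 : ℝ[X]) * a₃ ^ (4 : ℕ) * a₂ ^ (2 : ℕ) * a₁ * (X * derivative
          a₃) * (X * derivative a₀) - (12 : ℝ[X]) * a₃ ^ (4 : ℕ) * a₂ ^ (2 : ℕ) * a₁ * (X * derivative a₂) * (X * derivative a₁) + (2 : ℝ[X]) * a₃ ^ (4 : ℕ) * a₂ ^ (2 : ℕ) * a₀ * (X *
          derivative a₃) * (X * derivative a₁) + a₃ ^ (4 : ℕ) * a₂ ^ (2 : ℕ) * a₀ * (X * derivative a₂) ^ (2 : ℕ) + (12 : ℝ[X]) * a₃ ^ (4 : ℕ) * a₂ * a₁ ^ (3 : ℕ) * (X * derivative (X *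
          derivative a₃)) - (2 : ℝ[X]) * a₃ ^ (4 : ℕ) * a₂ * a₁ ^ (2 : ℕ) * (X * derivative a₃) * (X * derivative a₁) - a₃ ^ (4 : ℕ) * a₂ * a₁ ^ (2 : ℕ) * (X * derivative a₂) ^ (2 : ℕ) + (32
          : ℝ[X]) * a₃ ^ (4 : ℕ) * a₂ * a₁ * a₀ * (X * derivative a₃) * (X * derivative a₂) + (19 : ℝ[X]) * a₃ ^ (4 : ℕ) * a₂ * a₀ ^ (2 : ℕ) * (X * derivative a₃) ^ (2 : ℕ) + (4 : ℝ[X]) * a₃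
          ^ (4 : ℕ) * a₁ ^ (3 : ℕ) * (X * derivative a₃) * (X * derivative a₂) + (17 : ℝ[X]) * a₃ ^ (4 : ℕ) * a₁ ^ (2 : ℕ) * a₀ * (X * derivative a₃) ^ (2 : ℕ) - a₃ ^ (3 : ℕ) * a₂ ^ (5 : ℕ)
          * (X * derivative (X * derivative a₁)) - (7 : ℝ[X]) * a₃ ^ (3 : ℕ) * a₂ ^ (4 : ℕ) * a₁ * (X * derivative (X * derivative a₂)) - (9 : ℝ[X]) * a₃ ^ (3 : ℕ) * a₂ ^ (4 : ℕ) * a₀ * (X *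
          derivative (X * derivative a₃)) + (4 : ℝ[X]) * a₃ ^ (3 : ℕ) * a₂ ^ (4 : ℕ) * (X * derivative a₃) * (X * derivative a₀) + (4 : ℝ[X]) * a₃ ^ (3 : ℕ) * a₂ ^ (4 : ℕ) * (X * derivative
          a₂) * (X * derivative a₁) - (19 : ℝ[X]) * a₃ ^ (3 : ℕ) * a₂ ^ (3 : ℕ) * a₁ ^ (2 : ℕ) * (X * derivative (X * derivative a₃)) + (6 : ℝ[X]) * a₃ ^ (3 : ℕ) * a₂ ^ (3 : ℕ) * a₁ * (X *
          derivative a₃) * (X * derivative a₁) + (3 : ℝ[X]) * a₃ ^ (3 : ℕ) * a₂ ^ (3 : ℕ) * a₁ * (X * derivative a₂) ^ (2 : ℕ) - (12 : ℝ[X]) * a₃ ^ (3 : ℕ) * a₂ ^ (3 : ℕ) * a₀ * (X *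
          derivative a₃) * (X * derivative a₂) - (12 : ℝ[X]) * a₃ ^ (3 : ℕ) * a₂ ^ (2 : ℕ) * a₁ ^ (2 : ℕ) * (X * derivative a₃) * (X * derivative a₂) - (45 : ℝ[X]) * a₃ ^ (3 : ℕ) * a₂ ^ (2 :
          ℕ) * a₁ * a₀ * (X * derivative a₃) ^ (2 : ℕ) - (13 : ℝ[X]) * a₃ ^ (3 : ℕ) * a₂ * a₁ ^ (3 : ℕ) * (X * derivative a₃) ^ (2 : ℕ) + a₃ ^ (2 : ℕ) * a₂ ^ (6 : ℕ) * (X * derivative (X *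
          derivative a₂)) + (8 : ℝ[X]) * a₃ ^ (2 : ℕ) * a₂ ^ (5 : ℕ) * a₁ * (X * derivative (X * derivative a₃)) - (2 : ℝ[X]) * a₃ ^ (2 : ℕ) * a₂ ^ (5 : ℕ) * (X * derivative a₃) * (X *
          derivative a₁) - a₃ ^ (2 : ℕ) * a₂ ^ (5 : ℕ) * (X * derivative a₂) ^ (2 : ℕ) + (4 : ℝ[X]) * a₃ ^ (2 : ℕ) * a₂ ^ (4 : ℕ) * a₁ * (X * derivative a₃) * (X * derivative a₂) + (13 :
          ℝ[X]) * a₃ ^ (2 : ℕ) * a₂ ^ (4 : ℕ) * a₀ * (X * derivative a₃) ^ (2 : ℕ) + (22 : ℝ[X]) * a₃ ^ (2 : ℕ) * a₂ ^ (3 : ℕ) * a₁ ^ (2 : ℕ) * (X * derivative a₃) ^ (2 : ℕ) - a₃ * a₂ ^ (7 :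
          ℕ) * (X * derivative (X * derivative a₃)) - (9 : ℝ[X]) * a₃ * a₂ ^ (5 : ℕ) * a₁ * (X * derivative a₃) ^ (2 : ℕ) + a₂ ^ (7 : ℕ) * (X * derivative a₃) ^ (2 : ℕ))
    (hR1 : R₁ = (12 : ℝ[X]) * a₃ ^ (6 : ℕ) * a₁ * a₀ * (X * derivative (X * derivative a₀)) - (8 : ℝ[X]) * a₃ ^ (6 : ℕ) * a₁ * (X * derivative a₀) ^ (2 : ℕ) + (9 : ℝ[X]) * a₃ ^ (6 : ℕ) * a₀ ^ (2 :
          ℕ) * (X * derivative (X * derivative a₁)) - (12 : ℝ[X]) * a₃ ^ (6 : ℕ) * a₀ * (X * derivative a₁) * (X * derivative a₀) - a₃ ^ (5 : ℕ) * a₂ ^ (2 : ℕ) * a₀ * (X * derivative (X *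
          derivative a₀)) - (4 : ℝ[X]) * a₃ ^ (5 : ℕ) * a₂ * a₁ ^ (2 : ℕ) * (X * derivative (X * derivative a₀)) - (10 : ℝ[X]) * a₃ ^ (5 : ℕ) * a₂ * a₁ * a₀ * (X * derivative (X * derivative
          a₁)) + (8 : ℝ[X]) * a₃ ^ (5 : ℕ) * a₂ * a₁ * (X * derivative a₁) * (X * derivative a₀) - (6 : ℝ[X]) * a₃ ^ (5 : ℕ) * a₂ * a₀ ^ (2 : ℕ) * (X * derivative (X * derivative a₂)) + (6 :
          ℝ[X]) * a₃ ^ (5 : ℕ) * a₂ * a₀ * (X * derivative a₂) * (X * derivative a₀) + (3 : ℝ[X]) * a₃ ^ (5 : ℕ) * a₂ * a₀ * (X * derivative a₁) ^ (2 : ℕ) - (4 : ℝ[X]) * a₃ ^ (5 : ℕ) * a₁ ^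
          (3 : ℕ) * (X * derivative (X * derivative a₁)) - (16 : ℝ[X]) * a₃ ^ (5 : ℕ) * a₁ ^ (2 : ℕ) * a₀ * (X * derivative (X * derivative a₂)) + (8 : ℝ[X]) * a₃ ^ (5 : ℕ) * a₁ ^ (2 : ℕ) *
          (X * derivative a₂) * (X * derivative a₀) + (4 : ℝ[X]) * a₃ ^ (5 : ℕ) * a₁ ^ (2 : ℕ) * (X * derivative a₁) ^ (2 : ℕ) - (21 : ℝ[X]) * a₃ ^ (5 : ℕ) * a₁ * a₀ ^ (2 : ℕ) * (X *
          derivative (X * derivative a₃)) + (4 : ℝ[X]) * a₃ ^ (5 : ℕ) * a₁ * a₀ * (X * derivative a₃) * (X * derivative a₀) + (4 : ℝ[X]) * a₃ ^ (5 : ℕ) * a₁ * a₀ * (X * derivative a₂) * (X *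
          derivative a₁) - (6 : ℝ[X]) * a₃ ^ (5 : ℕ) * a₀ ^ (2 : ℕ) * (X * derivative a₃) * (X * derivative a₁) - (3 : ℝ[X]) * a₃ ^ (5 : ℕ) * a₀ ^ (2 : ℕ) * (X * derivative a₂) ^ (2 : ℕ) +
          a₃ ^ (4 : ℕ) * a₂ ^ (3 : ℕ) * a₁ * (X * derivative (X * derivative a₀)) + a₃ ^ (4 : ℕ) * a₂ ^ (3 : ℕ) * a₀ * (X * derivative (X * derivative a₁)) + (5 : ℝ[X]) * a₃ ^ (4 : ℕ) * a₂ ^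
          (2 : ℕ) * a₁ ^ (2 : ℕ) * (X * derivative (X * derivative a₁)) + (12 : ℝ[X]) * a₃ ^ (4 : ℕ) * a₂ ^ (2 : ℕ) * a₁ * a₀ * (X * derivative (X * derivative a₂)) - (6 : ℝ[X]) * a₃ ^ (4 :
          ℕ) * a₂ ^ (2 : ℕ) * a₁ * (X * derivative a₂) * (X * derivative a₀) - (3 : ℝ[X]) * a₃ ^ (4 : ℕ) * a₂ ^ (2 : ℕ) * a₁ * (X * derivative a₁) ^ (2 : ℕ) + (7 : ℝ[X]) * a₃ ^ (4 : ℕ) * a₂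
          ^ (2 : ℕ) * a₀ ^ (2 : ℕ) * (X * derivative (X * derivative a₃)) - (4 : ℝ[X]) * a₃ ^ (4 : ℕ) * a₂ ^ (2 : ℕ) * a₀ * (X * derivative a₃) * (X * derivative a₀) - (4 : ℝ[X]) * a₃ ^ (4 :
          ℕ) * a₂ ^ (2 : ℕ) * a₀ * (X * derivative a₂) * (X * derivative a₁) + (8 : ℝ[X]) * a₃ ^ (4 : ℕ) * a₂ * a₁ ^ (3 : ℕ) * (X * derivative (X * derivative a₂)) + (30 : ℝ[X]) * a₃ ^ (4 :
          ℕ) * a₂ * a₁ ^ (2 : ℕ) * a₀ * (X * derivative (X * derivative a₃)) - (8 : ℝ[X]) * a₃ ^ (4 : ℕ) * a₂ * a₁ ^ (2 : ℕ) * (X * derivative a₃) * (X * derivative a₀) - (8 : ℝ[X]) * a₃ ^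
          (4 : ℕ) * a₂ * a₁ ^ (2 : ℕ) * (X * derivative a₂) * (X * derivative a₁) + (2 : ℝ[X]) * a₃ ^ (4 : ℕ) * a₂ * a₁ * a₀ * (X * derivative a₃) * (X * derivative a₁) + a₃ ^ (4 : ℕ) * a₂ *
          a₁ * a₀ * (X * derivative a₂) ^ (2 : ℕ) + (12 : ℝ[X]) * a₃ ^ (4 : ℕ) * a₂ * a₀ ^ (2 : ℕ) * (X * derivative a₃) * (X * derivative a₂) + (4 : ℝ[X]) * a₃ ^ (4 : ℕ) * a₁ ^ (4 : ℕ) * (X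
          * derivative (X * derivative a₃)) + (20 : ℝ[X]) * a₃ ^ (4 : ℕ) * a₁ ^ (2 : ℕ) * a₀ * (X * derivative a₃) * (X * derivative a₂) + (22 : ℝ[X]) * a₃ ^ (4 : ℕ) * a₁ * a₀ ^ (2 : ℕ) * (X
          * derivative a₃) ^ (2 : ℕ) - a₃ ^ (3 : ℕ) * a₂ ^ (4 : ℕ) * a₁ * (X * derivative (X * derivative a₁)) - a₃ ^ (3 : ℕ) * a₂ ^ (4 : ℕ) * a₀ * (X * derivative (X * derivative a₂)) - (6
          : ℝ[X]) * a₃ ^ (3 : ℕ) * a₂ ^ (3 : ℕ) * a₁ ^ (2 : ℕ) * (X * derivative (X * derivative a₂)) - (14 : ℝ[X]) * a₃ ^ (3 : ℕ) * a₂ ^ (3 : ℕ) * a₁ * a₀ * (X * derivative (X * derivative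
          a₃)) + (4 : ℝ[X]) * a₃ ^ (3 : ℕ) * a₂ ^ (3 : ℕ) * a₁ * (X * derivative a₃) * (X * derivative a₀) + (4 : ℝ[X]) * a₃ ^ (3 : ℕ) * a₂ ^ (3 : ℕ) * a₁ * (X * derivative a₂) * (X *
          derivative a₁) + (2 : ℝ[X]) * a₃ ^ (3 : ℕ) * a₂ ^ (3 : ℕ) * a₀ * (X * derivative a₃) * (X * derivative a₁) + a₃ ^ (3 : ℕ) * a₂ ^ (3 : ℕ) * a₀ * (X * derivative a₂) ^ (2 : ℕ) - (13
          : ℝ[X]) * a₃ ^ (3 : ℕ) * a₂ ^ (2 : ℕ) * a₁ ^ (3 : ℕ) * (X * derivative (X * derivative a₃)) + (4 : ℝ[X]) * a₃ ^ (3 : ℕ) * a₂ ^ (2 : ℕ) * a₁ ^ (2 : ℕ) * (X * derivative a₃) * (X *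
          derivative a₁) + (2 : ℝ[X]) * a₃ ^ (3 : ℕ) * a₂ ^ (2 : ℕ) * a₁ ^ (2 : ℕ) * (X * derivative a₂) ^ (2 : ℕ) - (16 : ℝ[X]) * a₃ ^ (3 : ℕ) * a₂ ^ (2 : ℕ) * a₁ * a₀ * (X * derivative a₃)
          * (X * derivative a₂) - (11 : ℝ[X]) * a₃ ^ (3 : ℕ) * a₂ ^ (2 : ℕ) * a₀ ^ (2 : ℕ) * (X * derivative a₃) ^ (2 : ℕ) - (8 : ℝ[X]) * a₃ ^ (3 : ℕ) * a₂ * a₁ ^ (3 : ℕ) * (X * derivative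
          a₃) * (X * derivative a₂) - (37 : ℝ[X]) * a₃ ^ (3 : ℕ) * a₂ * a₁ ^ (2 : ℕ) * a₀ * (X * derivative a₃) ^ (2 : ℕ) - (4 : ℝ[X]) * a₃ ^ (3 : ℕ) * a₁ ^ (4 : ℕ) * (X * derivative a₃) ^
          (2 : ℕ) + a₃ ^ (2 : ℕ) * a₂ ^ (5 : ℕ) * a₁ * (X * derivative (X * derivative a₂)) + a₃ ^ (2 : ℕ) * a₂ ^ (5 : ℕ) * a₀ * (X * derivative (X * derivative a₃)) + (7 : ℝ[X]) * a₃ ^ (2 :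
          ℕ) * a₂ ^ (4 : ℕ) * a₁ ^ (2 : ℕ) * (X * derivative (X * derivative a₃)) - (2 : ℝ[X]) * a₃ ^ (2 : ℕ) * a₂ ^ (4 : ℕ) * a₁ * (X * derivative a₃) * (X * derivative a₁) - a₃ ^ (2 : ℕ) *
          a₂ ^ (4 : ℕ) * a₁ * (X * derivative a₂) ^ (2 : ℕ) + (4 : ℝ[X]) * a₃ ^ (2 : ℕ) * a₂ ^ (3 : ℕ) * a₁ ^ (2 : ℕ) * (X * derivative a₃) * (X * derivative a₂) + (19 : ℝ[X]) * a₃ ^ (2 : ℕ)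
          * a₂ ^ (3 : ℕ) * a₁ * a₀ * (X * derivative a₃) ^ (2 : ℕ) + (15 : ℝ[X]) * a₃ ^ (2 : ℕ) * a₂ ^ (2 : ℕ) * a₁ ^ (3 : ℕ) * (X * derivative a₃) ^ (2 : ℕ) - a₃ * a₂ ^ (6 : ℕ) * a₁ * (X *
          derivative (X * derivative a₃)) - a₃ * a₂ ^ (5 : ℕ) * a₀ * (X * derivative a₃) ^ (2 : ℕ) - (8 : ℝ[X]) * a₃ * a₂ ^ (4 : ℕ) * a₁ ^ (2 : ℕ) * (X * derivative a₃) ^ (2 : ℕ) + a₂ ^ (6 :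
          ℕ) * a₁ * (X * derivative a₃) ^ (2 : ℕ))
    (hR0 : R₀ = (9 : ℝ[X]) * a₃ ^ (6 : ℕ) * a₀ ^ (2 : ℕ) * (X * derivative (X * derivative a₀)) - (9 : ℝ[X]) * a₃ ^ (6 : ℕ) * a₀ * (X * derivative a₀) ^ (2 : ℕ) - (4 : ℝ[X]) * a₃ ^ (5 : ℕ) * a₂ *
          a₁ * a₀ * (X * derivative (X * derivative a₀)) - (6 : ℝ[X]) * a₃ ^ (5 : ℕ) * a₂ * a₀ ^ (2 : ℕ) * (X * derivative (X * derivative a₁)) + (8 : ℝ[X]) * a₃ ^ (5 : ℕ) * a₂ * a₀ * (X *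
          derivative a₁) * (X * derivative a₀) - (4 : ℝ[X]) * a₃ ^ (5 : ℕ) * a₁ ^ (2 : ℕ) * a₀ * (X * derivative (X * derivative a₁)) - (12 : ℝ[X]) * a₃ ^ (5 : ℕ) * a₁ * a₀ ^ (2 : ℕ) * (X *
          derivative (X * derivative a₂)) + (8 : ℝ[X]) * a₃ ^ (5 : ℕ) * a₁ * a₀ * (X * derivative a₂) * (X * derivative a₀) + (4 : ℝ[X]) * a₃ ^ (5 : ℕ) * a₁ * a₀ * (X * derivative a₁) ^ (2 :
          ℕ) - (9 : ℝ[X]) * a₃ ^ (5 : ℕ) * a₀ ^ (3 : ℕ) * (X * derivative (X * derivative a₃)) + a₃ ^ (4 : ℕ) * a₂ ^ (3 : ℕ) * a₀ * (X * derivative (X * derivative a₀)) + (5 : ℝ[X]) * a₃ ^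
          (4 : ℕ) * a₂ ^ (2 : ℕ) * a₁ * a₀ * (X * derivative (X * derivative a₁)) + (7 : ℝ[X]) * a₃ ^ (4 : ℕ) * a₂ ^ (2 : ℕ) * a₀ ^ (2 : ℕ) * (X * derivative (X * derivative a₂)) - (6 :
          ℝ[X]) * a₃ ^ (4 : ℕ) * a₂ ^ (2 : ℕ) * a₀ * (X * derivative a₂) * (X * derivative a₀) - (3 : ℝ[X]) * a₃ ^ (4 : ℕ) * a₂ ^ (2 : ℕ) * a₀ * (X * derivative a₁) ^ (2 : ℕ) + (8 : ℝ[X]) *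
          a₃ ^ (4 : ℕ) * a₂ * a₁ ^ (2 : ℕ) * a₀ * (X * derivative (X * derivative a₂)) + (22 : ℝ[X]) * a₃ ^ (4 : ℕ) * a₂ * a₁ * a₀ ^ (2 : ℕ) * (X * derivative (X * derivative a₃)) - (8 :
          ℝ[X]) * a₃ ^ (4 : ℕ) * a₂ * a₁ * a₀ * (X * derivative a₃) * (X * derivative a₀) - (8 : ℝ[X]) * a₃ ^ (4 : ℕ) * a₂ * a₁ * a₀ * (X * derivative a₂) * (X * derivative a₁) + (4 : ℝ[X])
          * a₃ ^ (4 : ℕ) * a₂ * a₀ ^ (2 : ℕ) * (X * derivative a₃) * (X * derivative a₁) + (2 : ℝ[X]) * a₃ ^ (4 : ℕ) * a₂ * a₀ ^ (2 : ℕ) * (X * derivative a₂) ^ (2 : ℕ) + (4 : ℝ[X]) * a₃ ^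
          (4 : ℕ) * a₁ ^ (3 : ℕ) * a₀ * (X * derivative (X * derivative a₃)) + (16 : ℝ[X]) * a₃ ^ (4 : ℕ) * a₁ * a₀ ^ (2 : ℕ) * (X * derivative a₃) * (X * derivative a₂) + (9 : ℝ[X]) * a₃ ^
          (4 : ℕ) * a₀ ^ (3 : ℕ) * (X * derivative a₃) ^ (2 : ℕ) - a₃ ^ (3 : ℕ) * a₂ ^ (4 : ℕ) * a₀ * (X * derivative (X * derivative a₁)) - (6 : ℝ[X]) * a₃ ^ (3 : ℕ) * a₂ ^ (3 : ℕ) * a₁ *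
          a₀ * (X * derivative (X * derivative a₂)) - (8 : ℝ[X]) * a₃ ^ (3 : ℕ) * a₂ ^ (3 : ℕ) * a₀ ^ (2 : ℕ) * (X * derivative (X * derivative a₃)) + (4 : ℝ[X]) * a₃ ^ (3 : ℕ) * a₂ ^ (3 :
          ℕ) * a₀ * (X * derivative a₃) * (X * derivative a₀) + (4 : ℝ[X]) * a₃ ^ (3 : ℕ) * a₂ ^ (3 : ℕ) * a₀ * (X * derivative a₂) * (X * derivative a₁) - (13 : ℝ[X]) * a₃ ^ (3 : ℕ) * a₂ ^
          (2 : ℕ) * a₁ ^ (2 : ℕ) * a₀ * (X * derivative (X * derivative a₃)) + (4 : ℝ[X]) * a₃ ^ (3 : ℕ) * a₂ ^ (2 : ℕ) * a₁ * a₀ * (X * derivative a₃) * (X * derivative a₁) + (2 : ℝ[X]) *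
          a₃ ^ (3 : ℕ) * a₂ ^ (2 : ℕ) * a₁ * a₀ * (X * derivative a₂) ^ (2 : ℕ) - (12 : ℝ[X]) * a₃ ^ (3 : ℕ) * a₂ ^ (2 : ℕ) * a₀ ^ (2 : ℕ) * (X * derivative a₃) * (X * derivative a₂) - (8 :
          ℝ[X]) * a₃ ^ (3 : ℕ) * a₂ * a₁ ^ (2 : ℕ) * a₀ * (X * derivative a₃) * (X * derivative a₂) - (28 : ℝ[X]) * a₃ ^ (3 : ℕ) * a₂ * a₁ * a₀ ^ (2 : ℕ) * (X * derivative a₃) ^ (2 : ℕ) - (4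
          : ℝ[X]) * a₃ ^ (3 : ℕ) * a₁ ^ (3 : ℕ) * a₀ * (X * derivative a₃) ^ (2 : ℕ) + a₃ ^ (2 : ℕ) * a₂ ^ (5 : ℕ) * a₀ * (X * derivative (X * derivative a₂)) + (7 : ℝ[X]) * a₃ ^ (2 : ℕ) *
          a₂ ^ (4 : ℕ) * a₁ * a₀ * (X * derivative (X * derivative a₃)) - (2 : ℝ[X]) * a₃ ^ (2 : ℕ) * a₂ ^ (4 : ℕ) * a₀ * (X * derivative a₃) * (X * derivative a₁) - a₃ ^ (2 : ℕ) * a₂ ^ (4 :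
          ℕ) * a₀ * (X * derivative a₂) ^ (2 : ℕ) + (4 : ℝ[X]) * a₃ ^ (2 : ℕ) * a₂ ^ (3 : ℕ) * a₁ * a₀ * (X * derivative a₃) * (X * derivative a₂) + (12 : ℝ[X]) * a₃ ^ (2 : ℕ) * a₂ ^ (3 : ℕ)
          * a₀ ^ (2 : ℕ) * (X * derivative a₃) ^ (2 : ℕ) + (15 : ℝ[X]) * a₃ ^ (2 : ℕ) * a₂ ^ (2 : ℕ) * a₁ ^ (2 : ℕ) * a₀ * (X * derivative a₃) ^ (2 : ℕ) - a₃ * a₂ ^ (6 : ℕ) * a₀ * (X *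
          derivative (X * derivative a₃)) - (8 : ℝ[X]) * a₃ * a₂ ^ (4 : ℕ) * a₁ * a₀ * (X * derivative a₃) ^ (2 : ℕ) + a₂ ^ (6 : ℕ) * a₀ * (X * derivative a₃) ^ (2 : ℕ))
    (hL1 : L₁ = (a₁ * R₂ ^ 2 - a₃ * R₀ * R₂ - a₂ * R₁ * R₂ + a₃ * R₁ ^ 2)) (hL0 : L₀ = (a₀ * R₂ ^ 2 - a₂ * R₀ * R₂ + a₃ * R₀ * R₁))
    (hfin : {p : Fin 2 → ℝ | 0 < p 0 ∧ 0 < p 1 ∧ MvPolynomial.eval p (∑ l, (MvPolynomial.X (0 : Fin 2) : MvPolynomial (Fin 2) ℝ) ^ d l • (S l).map (MvPolynomial.C : ℝ →+* MvPolynomial (Fin 2) ℝ) +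
      (MvPolynomial.X (1 : Fin 2) : MvPolynomial (Fin 2) ℝ) • (Matrix.fromBlocks 1 0 0 0 : Matrix (Fin 3 ⊕ Fin s) (Fin 3 ⊕ Fin s) ℝ).map (MvPolynomial.C : ℝ →+* MvPolynomial (Fin 2) ℝ)).det = 0 ∧
      MvPolynomial.eval p (MvPolynomial.X 0 * MvPolynomial.pderiv 0 (MvPolynomial.X 0 * MvPolynomial.pderiv 0 (∑ l, (MvPolynomial.X (0 : Fin 2) : MvPolynomial (Fin 2) ℝ) ^ d l • (S l).map
      (MvPolynomial.C : ℝ →+* MvPolynomial (Fin 2) ℝ) + (MvPolynomial.X (1 : Fin 2) : MvPolynomial (Fin 2) ℝ) • (Matrix.fromBlocks 1 0 0 0 : Matrix (Fin 3 ⊕ Fin s) (Fin 3 ⊕ Fin s) ℝ).map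
      (MvPolynomial.C : ℝ →+* MvPolynomial (Fin 2) ℝ)).det) * (MvPolynomial.X 1 * MvPolynomial.pderiv 1 (∑ l, (MvPolynomial.X (0 : Fin 2) : MvPolynomial (Fin 2) ℝ) ^ d l • (S l).map
      (MvPolynomial.C : ℝ →+* MvPolynomial (Fin 2) ℝ) + (MvPolynomial.X (1 : Fin 2) : MvPolynomial (Fin 2) ℝ) • (Matrix.fromBlocks 1 0 0 0 : Matrix (Fin 3 ⊕ Fin s) (Fin 3 ⊕ Fin s) ℝ).map
      (MvPolynomial.C : ℝ →+* MvPolynomial (Fin 2) ℝ)).det) ^ 2 - 2 * (MvPolynomial.X 0 * MvPolynomial.pderiv 0 (MvPolynomial.X 1 * MvPolynomial.pderiv 1 (∑ l, (MvPolynomial.X (0 : Fin 2) :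
      MvPolynomial (Fin 2) ℝ) ^ d l • (S l).map (MvPolynomial.C : ℝ →+* MvPolynomial (Fin 2) ℝ) + (MvPolynomial.X (1 : Fin 2) : MvPolynomial (Fin 2) ℝ) • (Matrix.fromBlocks 1 0 0 0 : Matrix (Fin 3
      ⊕ Fin s) (Fin 3 ⊕ Fin s) ℝ).map (MvPolynomial.C : ℝ →+* MvPolynomial (Fin 2) ℝ)).det)) * (MvPolynomial.X 0 * MvPolynomial.pderiv 0 (∑ l, (MvPolynomial.X (0 : Fin 2) : MvPolynomial (Fin 2) ℝ)
      ^ d l • (S l).map (MvPolynomial.C : ℝ →+* MvPolynomial (Fin 2) ℝ) + (MvPolynomial.X (1 : Fin 2) : MvPolynomial (Fin 2) ℝ) • (Matrix.fromBlocks 1 0 0 0 : Matrix (Fin 3 ⊕ Fin s) (Fin 3 ⊕ Fin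
      s) ℝ).map (MvPolynomial.C : ℝ →+* MvPolynomial (Fin 2) ℝ)).det) * (MvPolynomial.X 1 * MvPolynomial.pderiv 1 (∑ l, (MvPolynomial.X (0 : Fin 2) : MvPolynomial (Fin 2) ℝ) ^ d l • (S l).map
      (MvPolynomial.C : ℝ →+* MvPolynomial (Fin 2) ℝ) + (MvPolynomial.X (1 : Fin 2) : MvPolynomial (Fin 2) ℝ) • (Matrix.fromBlocks 1 0 0 0 : Matrix (Fin 3 ⊕ Fin s) (Fin 3 ⊕ Fin s) ℝ).map
      (MvPolynomial.C : ℝ →+* MvPolynomial (Fin 2) ℝ)).det) + MvPolynomial.X 1 * MvPolynomial.pderiv 1 (MvPolynomial.X 1 * MvPolynomial.pderiv 1 (∑ l, (MvPolynomial.X (0 : Fin 2) : MvPolynomial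
      (Fin 2) ℝ) ^ d l • (S l).map (MvPolynomial.C : ℝ →+* MvPolynomial (Fin 2) ℝ) + (MvPolynomial.X (1 : Fin 2) : MvPolynomial (Fin 2) ℝ) • (Matrix.fromBlocks 1 0 0 0 : Matrix (Fin 3 ⊕ Fin s)
      (Fin 3 ⊕ Fin s) ℝ).map (MvPolynomial.C : ℝ →+* MvPolynomial (Fin 2) ℝ)).det) * (MvPolynomial.X 0 * MvPolynomial.pderiv 0 (∑ l, (MvPolynomial.X (0 : Fin 2) : MvPolynomial (Fin 2) ℝ) ^ d l •
      (S l).map (MvPolynomial.C : ℝ →+* MvPolynomial (Fin 2) ℝ) + (MvPolynomial.X (1 : Fin 2) : MvPolynomial (Fin 2) ℝ) • (Matrix.fromBlocks 1 0 0 0 : Matrix (Fin 3 ⊕ Fin s) (Fin 3 ⊕ Fin s) ℝ).map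
      (MvPolynomial.C : ℝ →+* MvPolynomial (Fin 2) ℝ)).det) ^ 2) = 0}.Finite)
    (W : List (ℝ × ℝ)) (hsep : W.Pairwise (fun v w => v.2 < w.1))
    (hW : ∀ w ∈ W, 0 < w.1 ∧ w.1 ≤ w.2 ∧
      (∀ x, w.1 ≤ x → x ≤ w.2 → L₁.eval x * L₀.eval x < 0 ∧ R₂.eval x ≠ 0 ∧ a₃.eval x ≠ 0) ∧
      (R₂ * L₀ ^ 2 - R₁ * L₀ * L₁ + R₀ * L₁ ^ 2).eval w.1 * (R₂ * L₀ ^ 2 - R₁ * L₀ * L₁ + R₀ * L₁ ^ 2).eval w.2 ≤ 0) :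
    W.length ≤ {p : Fin 2 → ℝ | 0 < p 0 ∧ 0 < p 1 ∧ MvPolynomial.eval p (∑ l, (MvPolynomial.X (0 : Fin 2) : MvPolynomial (Fin 2) ℝ) ^ d l • (S l).map (MvPolynomial.C : ℝ →+* MvPolynomial (Fin 2) ℝ) +
      (MvPolynomial.X (1 : Fin 2) : MvPolynomial (Fin 2) ℝ) • (Matrix.fromBlocks 1 0 0 0 : Matrix (Fin 3 ⊕ Fin s) (Fin 3 ⊕ Fin s) ℝ).map (MvPolynomial.C : ℝ →+* MvPolynomial (Fin 2) ℝ)).det = 0 ∧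
      MvPolynomial.eval p (MvPolynomial.X 0 * MvPolynomial.pderiv 0 (MvPolynomial.X 0 * MvPolynomial.pderiv 0 (∑ l, (MvPolynomial.X (0 : Fin 2) : MvPolynomial (Fin 2) ℝ) ^ d l • (S l).map
      (MvPolynomial.C : ℝ →+* MvPolynomial (Fin 2) ℝ) + (MvPolynomial.X (1 : Fin 2) : MvPolynomial (Fin 2) ℝ) • (Matrix.fromBlocks 1 0 0 0 : Matrix (Fin 3 ⊕ Fin s) (Fin 3 ⊕ Fin s) ℝ).map
      (MvPolynomial.C : ℝ →+* MvPolynomial (Fin 2) ℝ)).det) * (MvPolynomial.X 1 * MvPolynomial.pderiv 1 (∑ l, (MvPolynomial.X (0 : Fin 2) : MvPolynomial (Fin 2) ℝ) ^ d l • (S l).map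
      (MvPolynomial.C : ℝ →+* MvPolynomial (Fin 2) ℝ) + (MvPolynomial.X (1 : Fin 2) : MvPolynomial (Fin 2) ℝ) • (Matrix.fromBlocks 1 0 0 0 : Matrix (Fin 3 ⊕ Fin s) (Fin 3 ⊕ Fin s) ℝ).map
      (MvPolynomial.C : ℝ →+* MvPolynomial (Fin 2) ℝ)).det) ^ 2 - 2 * (MvPolynomial.X 0 * MvPolynomial.pderiv 0 (MvPolynomial.X 1 * MvPolynomial.pderiv 1 (∑ l, (MvPolynomial.X (0 : Fin 2) :
      MvPolynomial (Fin 2) ℝ) ^ d l • (S l).map (MvPolynomial.C : ℝ →+* MvPolynomial (Fin 2) ℝ) + (MvPolynomial.X (1 : Fin 2) : MvPolynomial (Fin 2) ℝ) • (Matrix.fromBlocks 1 0 0 0 : Matrix (Fin 3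
      ⊕ Fin s) (Fin 3 ⊕ Fin s) ℝ).map (MvPolynomial.C : ℝ →+* MvPolynomial (Fin 2) ℝ)).det)) * (MvPolynomial.X 0 * MvPolynomial.pderiv 0 (∑ l, (MvPolynomial.X (0 : Fin 2) : MvPolynomial (Fin 2) ℝ)
      ^ d l • (S l).map (MvPolynomial.C : ℝ →+* MvPolynomial (Fin 2) ℝ) + (MvPolynomial.X (1 : Fin 2) : MvPolynomial (Fin 2) ℝ) • (Matrix.fromBlocks 1 0 0 0 : Matrix (Fin 3 ⊕ Fin s) (Fin 3 ⊕ Fin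
      s) ℝ).map (MvPolynomial.C : ℝ →+* MvPolynomial (Fin 2) ℝ)).det) * (MvPolynomial.X 1 * MvPolynomial.pderiv 1 (∑ l, (MvPolynomial.X (0 : Fin 2) : MvPolynomial (Fin 2) ℝ) ^ d l • (S l).map
      (MvPolynomial.C : ℝ →+* MvPolynomial (Fin 2) ℝ) + (MvPolynomial.X (1 : Fin 2) : MvPolynomial (Fin 2) ℝ) • (Matrix.fromBlocks 1 0 0 0 : Matrix (Fin 3 ⊕ Fin s) (Fin 3 ⊕ Fin s) ℝ).map
      (MvPolynomial.C : ℝ →+* MvPolynomial (Fin 2) ℝ)).det) + MvPolynomial.X 1 * MvPolynomial.pderiv 1 (MvPolynomial.X 1 * MvPolynomial.pderiv 1 (∑ l, (MvPolynomial.X (0 : Fin 2) : MvPolynomial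
      (Fin 2) ℝ) ^ d l • (S l).map (MvPolynomial.C : ℝ →+* MvPolynomial (Fin 2) ℝ) + (MvPolynomial.X (1 : Fin 2) : MvPolynomial (Fin 2) ℝ) • (Matrix.fromBlocks 1 0 0 0 : Matrix (Fin 3 ⊕ Fin s)
      (Fin 3 ⊕ Fin s) ℝ).map (MvPolynomial.C : ℝ →+* MvPolynomial (Fin 2) ℝ)).det) * (MvPolynomial.X 0 * MvPolynomial.pderiv 0 (∑ l, (MvPolynomial.X (0 : Fin 2) : MvPolynomial (Fin 2) ℝ) ^ d l •
      (S l).map (MvPolynomial.C : ℝ →+* MvPolynomial (Fin 2) ℝ) + (MvPolynomial.X (1 : Fin 2) : MvPolynomial (Fin 2) ℝ) • (Matrix.fromBlocks 1 0 0 0 : Matrix (Fin 3 ⊕ Fin s) (Fin 3 ⊕ Fin s) ℝ).map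
      (MvPolynomial.C : ℝ →+* MvPolynomial (Fin 2) ℝ)).det) ^ 2) = 0}.ncard := by
  classical
  rw [hΦ] at hfin ⊢
  set Φ : MvPolynomial (Fin 2) ℝ := (MvPolynomial.X 1 * MvPolynomial.X 1 * MvPolynomial.X 1 * Polynomial.aeval (MvPolynomial.X 0 : MvPolynomial (Fin 2) ℝ) a₃ + MvPolynomial.X 1 * MvPolynomial.X 1 * Polynomial.aeval (MvPolynomial.X 0 : MvPolynomial (Fin 2) ℝ) a₂ + MvPolynomial.X 1 * Polynomial.aeval (MvPolynomial.X 0 : MvPolynomial (Fin 2) ℝ) a₁ + Polynomial.aeval (MvPolynomial.X 0 : MvPolynomial (Fin 2) ℝ) a₀) with hΦdef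
  set N : ℝ[X] := (R₂ * L₀ ^ 2 - R₁ * L₀ * L₁ + R₀ * L₁ ^ 2) with hNdef
  set osc := {p : Fin 2 → ℝ | 0 < p 0 ∧ 0 < p 1 ∧ MvPolynomial.eval p Φ = 0 ∧
      MvPolynomial.eval p
        (MvPolynomial.X 0 * MvPolynomial.pderiv 0 (MvPolynomial.X 0 * MvPolynomial.pderiv 0 Φ)
            * (MvPolynomial.X 1 * MvPolynomial.pderiv 1 Φ) ^ 2
          - 2 * (MvPolynomial.X 0 * MvPolynomial.pderiv 0 (MvPolynomial.X 1 * MvPolynomial.pderiv 1 Φ))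
            * (MvPolynomial.X 0 * MvPolynomial.pderiv 0 Φ) * (MvPolynomial.X 1 * MvPolynomial.pderiv 1 Φ)
          + MvPolynomial.X 1 * MvPolynomial.pderiv 1 (MvPolynomial.X 1 * MvPolynomial.pderiv 1 Φ)
            * (MvPolynomial.X 0 * MvPolynomial.pderiv 0 Φ) ^ 2) = 0} with hosc
  -- from real numbers to the set (over `a₃ ≠ 0`, `R₂ ≠ 0`, `L₁ ≠ 0`)
  have mem_of : ∀ p : Fin 2 → ℝ, 0 < p 0 → 0 < p 1 → a₃.eval (p 0) ≠ 0 → R₂.eval (p 0) ≠ 0 → L₁.eval (p 0) ≠ 0 →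
      L₁.eval (p 0) * p 1 + L₀.eval (p 0) = 0 → N.eval (p 0) = 0 → p ∈ osc := by
    intro p h0 hp1 ha hR hLt hl hn
    -- the Hessian quadratic vanishes: `N = L₁² · Q`
    have hNq : N.eval (p 0) = L₁.eval (p 0) ^ 2 * (R₂.eval (p 0) * p 1 ^ 2 + R₁.eval (p 0) * p 1 + R₀.eval (p 0)) := by
      have h0' : L₀.eval (p 0) = -(L₁.eval (p 0) * p 1) := by linarith
      rw [hNdef]
      simp only [eval_add, eval_sub, eval_mul, eval_pow]
      rw [h0']
      ring
    have hQ : R₂.eval (p 0) * p 1 ^ 2 + R₁.eval (p 0) * p 1 + R₀.eval (p 0) = 0 := by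
      rw [hn] at hNq
      exact (mul_eq_zero.1 hNq.symm).resolve_left (pow_ne_zero 2 hLt)
    -- the cubic vanishes: `R₂² Ψ = q·Q + (L₁ b + L₀)`
    have hE : R₂.eval (p 0) ^ 2 * (a₃.eval (p 0) * p 1 ^ 3 + a₂.eval (p 0) * p 1 ^ 2 + a₁.eval (p 0) * p 1 + a₀.eval (p 0)) =
        (a₃.eval (p 0) * R₂.eval (p 0) * p 1 + (a₂.eval (p 0) * R₂.eval (p 0) - a₃.eval (p 0) * R₁.eval (p 0)))
            * (R₂.eval (p 0) * p 1 ^ 2 + R₁.eval (p 0) * p 1 + R₀.eval (p 0))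
          + (L₁.eval (p 0) * p 1 + L₀.eval (p 0)) := by
      rw [hL1, hL0]
      simp only [eval_add, eval_sub, eval_mul, eval_pow]
      ring
    have hΨ0 : a₃.eval (p 0) * p 1 ^ 3 + a₂.eval (p 0) * p 1 ^ 2 + a₁.eval (p 0) * p 1 + a₀.eval (p 0) = 0 := by
      rw [hQ, hl, mul_zero, zero_add] at hE
      exact (mul_eq_zero.1 hE).resolve_left (pow_ne_zero 2 hR)
    refine ⟨h0, hp1, ?_, ?_⟩
    · rw [hΦdef, OsculationCuspCubic.eval_Psi3]; exact hΨ0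
    · rw [OsculationCuspCubic.eval_logHessian_Psi3 a₃ a₂ a₁ a₀ Φ hΦdef p]
      have hred := OsculationRankThree.hess_pseudo_reduce_poly3 a₃ a₂ a₁ a₀ (p 0) (p 1) hΨ0
      rw [← hR2, ← hR1, ← hR0, hQ] at hred
      exact (mul_eq_zero.1 hred).resolve_left (pow_ne_zero 6 ha)
  -- index the windows
  set k := W.length with hk
  set l : Fin k → ℝ := fun i => (W.get i).1 with hl
  set u : Fin k → ℝ := fun i => (W.get i).2 with hu
  have hWi : ∀ i : Fin k, 0 < l i ∧ l i ≤ u i ∧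
      (∀ x, l i ≤ x → x ≤ u i → L₁.eval x * L₀.eval x < 0 ∧ R₂.eval x ≠ 0 ∧ a₃.eval x ≠ 0) ∧
      N.eval (l i) * N.eval (u i) ≤ 0 := fun i => by
    simpa [hl, hu, hNdef] using hW (W.get i) (List.get_mem W i)
  have hsep' : ∀ i j : Fin k, i < j → u i < l j := by
    intro i j hij
    have := List.pairwise_iff_get.1 hsep i j hij
    simpa [hl, hu] using this
  have hroot : ∀ i, ∃ t, l i ≤ t ∧ t ≤ u i ∧ N.eval t = 0 := fun i =>
    exists_root_of_mul_nonpos N (hWi i).2.1 (hWi i).2.2.2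
  choose t ht using hroot
  set pt : Fin k → (Fin 2 → ℝ) := fun i => ![t i, -L₀.eval (t i) / L₁.eval (t i)] with hpt
  have hmem : ∀ i, pt i ∈ osc := by
    intro i
    obtain ⟨htl, htu, hNt⟩ := ht i
    obtain ⟨hs, hR, ha⟩ := (hWi i).2.2.1 (t i) htl htu
    have hLt : L₁.eval (t i) ≠ 0 := fun h => by rw [h, zero_mul] at hs; exact lt_irrefl _ hs
    have ht0 : 0 < t i := lt_of_lt_of_le (hWi i).1 htl
    have hb : 0 < -L₀.eval (t i) / L₁.eval (t i) := by
      have hL2 : 0 < L₁.eval (t i) ^ 2 := by positivity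
      have : -L₀.eval (t i) / L₁.eval (t i) = -(L₁.eval (t i) * L₀.eval (t i)) / L₁.eval (t i) ^ 2 := by
        field_simp
      rw [this]
      exact div_pos (by linarith) hL2
    have hline : L₁.eval (t i) * (-L₀.eval (t i) / L₁.eval (t i)) + L₀.eval (t i) = 0 := by
      field_simp
      ring
    refine mem_of (pt i) ?_ ?_ ?_ ?_ ?_ ?_ ?_
    · simpa [hpt] using ht0
    · simpa [hpt] using hb
    · simpa [hpt] using ha
    · simpa [hpt] using hR
    · simpa [hpt] using hLt
    · simpa [hpt] using hline
    · simpa [hpt] using hNt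
  have hinj : Function.Injective pt := by
    intro i j hij
    have h0 : t i = t j := by
      have := congr_fun hij 0
      simpa [hpt] using this
    by_contra hne
    rcases lt_or_gt_of_ne hne with h | h
    · have := hsep' i j h
      linarith [(ht i).2.1, (ht j).1]
    · have := hsep' j i h
      linarith [(ht j).2.1, (ht i).1]
  have hsub : ↑(Finset.univ.image pt) ⊆ osc := by
    intro p hp
    rw [Finset.mem_coe, Finset.mem_image] at hp
    obtain ⟨i, -, rfl⟩ := hp
    exact hmem i
  calc k = (Finset.univ.image pt).card := by rw [Finset.card_image_of_injective _ hinj, Finset.card_univ, Fintype.card_fin]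
    _ = (↑(Finset.univ.image pt) : Set (Fin 2 → ℝ)).ncard := (Set.ncard_coe_finset _).symm
    _ ≤ osc.ncard := Set.ncard_le_ncard hsub hfin

end OsculationCensus

end Summit.ValiantsHypothesis.ValiantsHypothesis.Theorems.LacunarySymmetroidMatrixDescartes
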